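import Literature.Analysis.FluidPDE.FluidComputer.ThresholdLevelTableV
import HarnessLib

/-!
# Kernel run of the level-table checker over the box `V`, chunks 16 … 19 (bp3 gen 13, layer 4: robustness variant V)

HONEST FRAMING: low prior, high value-of-information experiment on Tao's machine paradigm; NOT a
claim that NS blows up.

Four kernel evaluations (`decide +kernel`; no `native_decide`, no extra axioms) of `runSteps`
with the interval gate data `GIv` (`ε, σ, r` within relative `3·10⁻²`, `δ ∈ [0, δ₀]`),
25 steps each, from `Bv16` to `Bv20`.
-/

namespace Literature.Analysis.FluidPDE.FluidComputer

namespace ThresholdLevelTable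

set_option maxHeartbeats 10000000 in
set_option maxRecDepth 200000 in
/-- Chunk 16 of the box-`V` table run (steps 400 … 424). [folklore] -/
theorem runV16 : runSteps 60 12 3 GIv RbIt Bv16 chunk16 9080207597954848 = some Bv17 := by
  decide +kernel

set_option maxHeartbeats 10000000 in
set_option maxRecDepth 200000 in
/-- Chunk 17 of the box-`V` table run (steps 425 … 449). [folklore] -/
theorem runV17 : runSteps 60 12 3 GIv RbIt Bv17 chunk17 10806933931377166 = some Bv18 := by
  decide +kernel

set_option maxHeartbeats 10000000 in
set_option maxRecDepth 200000 in
/-- Chunk 18 of the box-`V` table run (steps 450 … 474). [folklore] -/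
theorem runV18 : runSteps 60 12 3 GIv RbIt Bv18 chunk18 12862021020692962 = some Bv19 := by
  decide +kernel

set_option maxHeartbeats 10000000 in
set_option maxRecDepth 200000 in
/-- Chunk 19 of the box-`V` table run (steps 475 … 499). [folklore] -/
theorem runV19 : runSteps 60 12 3 GIv RbIt Bv19 chunk19 15307911178806116 = some Bv20 := by
  decide +kernel

end ThresholdLevelTable

end Literature.Analysis.FluidPDE.FluidComputer
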